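/-
Copyright: rh-split cell (screw, bridge) gen 14, 2026-08-27.  Splitting search over kernel-typed
RH-equivalences; this module is ζ-free analysis.  Nothing here bears on the truth of RH.
-/
import Summits.RiemannHypothesis.RiemannHypothesis.Theorems.Splittings.ScrewBorelContinuationA
import HarnessLib

/-!
# Analytic continuation through an aliased pole field — part B: residue at an isolated inside pole

Continuation of `ScrewBorelContinuationA` (same namespace `…Splittings.ScrewBorel`; see its module docstring
for the statement and proof outline of the kernel theorem `poleSet_eq_empty` and the walls theorem).
No `sorry`, no new axioms, no instances, no notation.
-/

set_option linter.dupNamespace false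

namespace Summit.RiemannHypothesis.RiemannHypothesis.Theorems.Splittings.ScrewBorel

open Complex Filter Topology Set Metric

/-! ## 5. Residue at an isolated inside pole: the total pole coefficient vanishes -/

/-- The coefficient that the term with data `(c, u)` contributes to the pole at `p`:
`c/2` if `u⁻¹ = p`, plus `c/2` if `u = p`. -/
noncomputable def poleCoeff (c u p : ℂ) : ℂ :=
  (if u⁻¹ = p then c / 2 else 0) + (if u = p then c / 2 else 0)

/-- The term minus its polar part at `p`. -/
noncomputable def regTerm (c u p z : ℂ) : ℂ :=
  c * ((1 / 2) * ((if u⁻¹ = p then 0 else (1 - u * z)⁻¹) + (if u = p then 0 else (1 - z / u)⁻¹)) -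
    (1 - z)⁻¹)

/-- `term = poleCoeff · (1 - z/p)⁻¹ + regTerm`. -/
theorem term_eq_poleCoeff_add_regTerm (c u p z : ℂ) :
    term c u z = poleCoeff c u p * (1 - z / p)⁻¹ + regTerm c u p z := by
  unfold term poleCoeff regTerm
  by_cases h1 : u⁻¹ = p
  · by_cases h2 : u = p
    · rw [if_pos h1, if_pos h2, if_pos h1, if_pos h2]
      have e1 : u * z = z / p := by rw [← h1, div_inv_eq_mul, mul_comm]
      rw [e1, h2]; ring
    · rw [if_pos h1, if_neg h2, if_pos h1, if_neg h2]
      have e1 : u * z = z / p := by rw [← h1, div_inv_eq_mul, mul_comm]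
      rw [e1]; ring
  · by_cases h2 : u = p
    · rw [if_neg h1, if_pos h2, if_neg h1, if_pos h2, h2]; ring
    · rw [if_neg h1, if_neg h2, if_neg h1, if_neg h2]; ring

/-- `‖poleCoeff c u p‖ ≤ ‖c‖`. -/
theorem norm_poleCoeff_le (c u p : ℂ) : ‖poleCoeff c u p‖ ≤ ‖c‖ := by
  unfold poleCoeff
  have h2 : ‖c / 2‖ = ‖c‖ / 2 := by rw [norm_div]; simp
  refine (norm_add_le _ _).trans ?_
  split_ifs <;> simp only [norm_zero, h2, add_zero, zero_add] <;> linarith [norm_nonneg c]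

/-- The real part of the pole coefficient is `≤ 0` when `Re c < 0` … -/
theorem re_poleCoeff_nonpos {c : ℂ} (hc : c.re < 0) (u p : ℂ) : (poleCoeff c u p).re ≤ 0 := by
  unfold poleCoeff
  have h2 : (c / 2).re = c.re / 2 := Complex.div_ofNat_re c 2
  rw [Complex.add_re]
  split_ifs <;> simp only [Complex.zero_re, h2, add_zero, zero_add] <;> linarith

/-- … and `< 0` when moreover `p = u` or `p = u⁻¹`. -/
theorem re_poleCoeff_neg {c : ℂ} (hc : c.re < 0) {u p : ℂ} (hp : p = u ∨ p = u⁻¹) :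
    (poleCoeff c u p).re < 0 := by
  unfold poleCoeff
  have h2 : (c / 2).re = c.re / 2 := Complex.div_ofNat_re c 2
  rw [Complex.add_re]
  rcases hp with hp | hp
  · rw [if_pos hp.symm]
    split_ifs <;> simp only [Complex.zero_re, h2, zero_add] <;> linarith
  · rw [if_pos hp.symm]
    split_ifs <;> simp only [Complex.zero_re, h2, add_zero] <;> linarith

/-- Bound on the regular part away from the OTHER poles: `‖z‖ ≤ r`, `0 < δ ≤ 1 - r`, and `z` `δ`-away
from the inside poles of this term other than `p` ⇒ `‖regTerm c u p z‖ ≤ 2‖c‖/δ`. -/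
theorem norm_regTerm_le {c u p z : ℂ} (hu : u ≠ 0) {r δ : ℝ} (hδ : 0 < δ) (hδr : δ ≤ 1 - r)
    (hz : ‖z‖ ≤ r) (hfar₁ : u⁻¹ ≠ p → ‖u⁻¹‖ < 1 → δ ≤ ‖u⁻¹ - z‖)
    (hfar₂ : u ≠ p → ‖u‖ < 1 → δ ≤ ‖u - z‖) : ‖regTerm c u p z‖ ≤ 2 * ‖c‖ / δ := by
  have h1 : ‖(if u⁻¹ = p then (0 : ℂ) else (1 - u * z)⁻¹)‖ ≤ δ⁻¹ := by
    split_ifs with h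
    · rw [norm_zero]; positivity
    · exact norm_inv_le_of_le hδ (le_norm_one_sub_mul hu hδr hz (hfar₁ h))
  have h2 : ‖(if u = p then (0 : ℂ) else (1 - z / u)⁻¹)‖ ≤ δ⁻¹ := by
    split_ifs with h
    · rw [norm_zero]; positivity
    · exact norm_inv_le_of_le hδ (le_norm_one_sub_div hu hδr hz (hfar₂ h))
  have h3 := norm_inv_le_of_le hδ (hδr.trans (one_sub_le_norm_one_sub hz))
  unfold regTerm
  rw [norm_mul]
  set A := (if u⁻¹ = p then (0 : ℂ) else (1 - u * z)⁻¹) with hA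
  set B := (if u = p then (0 : ℂ) else (1 - z / u)⁻¹) with hB
  have hin : ‖(1 / 2 : ℂ) * (A + B) - (1 - z)⁻¹‖ ≤ 2 / δ := by
    calc ‖(1 / 2 : ℂ) * (A + B) - (1 - z)⁻¹‖
        ≤ ‖(1 / 2 : ℂ) * (A + B)‖ + ‖(1 - z)⁻¹‖ := norm_sub_le _ _
      _ ≤ (1 / 2) * (δ⁻¹ + δ⁻¹) + δ⁻¹ := by
          gcongr
          rw [norm_mul]
          have : ‖(1 / 2 : ℂ)‖ = 1 / 2 := by simp
          rw [this]
          gcongr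
          exact (norm_add_le _ _).trans (add_le_add h1 h2)
      _ = 2 / δ := by ring
  calc ‖c‖ * ‖(1 / 2 : ℂ) * (A + B) - (1 - z)⁻¹‖ ≤ ‖c‖ * (2 / δ) := by gcongr
    _ = 2 * ‖c‖ / δ := by ring

/-- **Residue step.**  At an isolated inside pole `p` (`ε > 0`, `‖p‖ + 2ε < 1`, no other closure point
within `2ε`), if `F` is differentiable on the disc and equals the Borel series off the closure of the pole
set, then the total pole coefficient `∑' i, poleCoeff (c i) (u i) p` vanishes. -/
theorem tsum_poleCoeff_eq_zero {ι : Type*} {c u : ι → ℂ} (hc : Summable fun i ↦ ‖c i‖)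
    (hu : ∀ i, u i ≠ 0) {F : ℂ → ℂ} (hF : DifferentiableOn ℂ F (ball 0 1))
    (hFB : EqOn F (fun z ↦ ∑' i, term (c i) (u i) z) (ball 0 1 \ closure (poleSet u)))
    {p : ℂ} (hp : p ∈ poleSet u) {ε : ℝ} (hε : 0 < ε) (hpε : ‖p‖ + 2 * ε < 1)
    (hiso : ∀ q ∈ closure (poleSet u), ‖q - p‖ < 2 * ε → q = p) :
    ∑' i, poleCoeff (c i) (u i) p = 0 := by
  have hp1 : ‖p‖ < 1 := hp.1
  have hp0 : p ≠ 0 := by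
    obtain ⟨i, hi | hi⟩ := hp.2
    · rw [hi]; exact hu i
    · rw [hi]; exact inv_ne_zero (hu i)
  -- summability of the pole coefficients
  have hpc : Summable fun i ↦ poleCoeff (c i) (u i) p :=
    Summable.of_norm_bounded hc (fun i ↦ norm_poleCoeff_le _ _ _)
  set C : ℂ := ∑' i, poleCoeff (c i) (u i) p with hC
  -- the regular part is bounded by `M` on `ball p ε`
  set M : ℝ := 2 * (∑' i, ‖c i‖) / ε with hM
  have hM0 : 0 ≤ M := by
    have h0 : 0 ≤ ∑' i, ‖c i‖ := tsum_nonneg fun i ↦ norm_nonneg (c i)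
    rw [hM]; positivity
  have hreg : ∀ z : ℂ, ‖z - p‖ < ε →
      (Summable fun i ↦ regTerm (c i) (u i) p z) ∧ ‖∑' i, regTerm (c i) (u i) p z‖ ≤ M := by
    intro z hz
    have hzr : ‖z‖ ≤ ‖p‖ + ε := by
      have e : p + (z - p) = z := by ring
      have := norm_add_le p (z - p)
      rw [e] at this; linarith
    have hδr : ε ≤ 1 - (‖p‖ + ε) := by linarith
    have hb : ∀ i, ‖regTerm (c i) (u i) p z‖ ≤ 2 * ‖c i‖ / ε := by
      intro i
      refine norm_regTerm_le (hu i) hε hδr hzr (fun hne hlt ↦ ?_) (fun hne hlt ↦ ?_)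
      · have hq : (u i)⁻¹ ∈ closure (poleSet u) := subset_closure ⟨hlt, i, Or.inr rfl⟩
        have hfar : ¬ ‖(u i)⁻¹ - p‖ < 2 * ε := fun h ↦ hne (hiso _ hq h)
        have e : ((u i)⁻¹ - z) + (z - p) = (u i)⁻¹ - p := by ring
        have := norm_add_le ((u i)⁻¹ - z) (z - p)
        rw [e] at this
        push Not at hfar
        linarith
      · have hq : u i ∈ closure (poleSet u) := subset_closure ⟨hlt, i, Or.inl rfl⟩
        have hfar : ¬ ‖u i - p‖ < 2 * ε := fun h ↦ hne (hiso _ hq h)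
        have e : (u i - z) + (z - p) = u i - p := by ring
        have := norm_add_le (u i - z) (z - p)
        rw [e] at this
        push Not at hfar
        linarith
    have hsn : Summable fun i ↦ ‖regTerm (c i) (u i) p z‖ :=
      Summable.of_nonneg_of_le (fun i ↦ norm_nonneg _) hb ((hc.mul_left 2).div_const ε)
    refine ⟨hsn.of_norm, (norm_tsum_le_tsum_norm hsn).trans ?_⟩
    calc ∑' i, ‖regTerm (c i) (u i) p z‖ ≤ ∑' i, 2 * ‖c i‖ / ε :=
          hsn.tsum_le_tsum hb ((hc.mul_left 2).div_const ε)
      _ = M := by rw [hM, tsum_div_const, tsum_mul_left]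
  -- `F` is bounded near `p`
  have hFcont : ContinuousAt F p :=
    (hF.continuousOn.continuousAt (isOpen_ball.mem_nhds (mem_ball_zero_iff.2 hp1)))
  obtain ⟨η, hη, hFη⟩ := Metric.continuousAt_iff.1 hFcont 1 one_pos
  set L : ℝ := ‖F p‖ + 1 + M with hL
  have hL0 : 0 ≤ L := by rw [hL]; positivity
  -- the key estimate along `z_t = p (1 - t)`
  have key : ∀ t : ℝ, 0 < t → t < min ε η → ‖C‖ ≤ t * L := by
    intro t ht htm
    have htε : t < ε := lt_of_lt_of_le htm (min_le_left _ _)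
    have htη : t < η := lt_of_lt_of_le htm (min_le_right _ _)
    have ht1 : t < 1 := by linarith [norm_nonneg p]
    set z : ℂ := p * (1 - t) with hz
    have hzp : ‖z - p‖ < t := by
      have e : z - p = -(p * t) := by rw [hz]; ring
      rw [e, norm_neg, norm_mul, Complex.norm_real, Real.norm_eq_abs, abs_of_pos ht]
      calc ‖p‖ * t < 1 * t := by gcongr
        _ = t := one_mul t
    have hz1 : z ∈ ball (0 : ℂ) 1 := by
      rw [mem_ball_zero_iff, hz, norm_mul]
      have : ‖(1 - t : ℂ)‖ = 1 - t := by
        rw [show (1 - t : ℂ) = ((1 - t : ℝ) : ℂ) by push_cast; ring, Complex.norm_real,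
          Real.norm_eq_abs, abs_of_pos (by linarith)]
      rw [this]
      calc ‖p‖ * (1 - t) < 1 * (1 - t) := by gcongr
        _ ≤ 1 := by linarith
    have hzcl : z ∉ closure (poleSet u) := by
      intro h
      have := hiso z h (by linarith)
      have e : p * (1 - t) - p = -(p * t) := by ring
      have h0 : (p : ℂ) * t = 0 := by
        have : z - p = 0 := by rw [this, sub_self]
        rw [hz, e, neg_eq_zero] at this; exact this
      rcases mul_eq_zero.1 h0 with h0 | h0
      · exact hp0 h0
      · exact ht.ne' (by exact_mod_cast h0)
    have hFz : F z = ∑' i, term (c i) (u i) z := hFB ⟨hz1, hzcl⟩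
    -- `1 - z/p = t`
    have hw : (1 - z / p)⁻¹ = ((t : ℂ))⁻¹ := by
      rw [hz, mul_div_cancel_left₀ _ hp0]; ring
    obtain ⟨hrs, hrb⟩ := hreg z (hzp.trans htε)
    have hsplit : ∑' i, term (c i) (u i) z = C * ((t : ℂ))⁻¹ + ∑' i, regTerm (c i) (u i) p z := by
      have h1 : ∀ i, term (c i) (u i) z =
          poleCoeff (c i) (u i) p * ((t : ℂ))⁻¹ + regTerm (c i) (u i) p z := by
        intro i; rw [term_eq_poleCoeff_add_regTerm (c i) (u i) p z, hw]
      simp_rw [h1]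
      rw [(hpc.mul_right _).tsum_add hrs, tsum_mul_right]
    have hdist : dist z p < η := by rw [dist_eq_norm]; exact hzp.trans htη
    have hFb : ‖F z‖ ≤ ‖F p‖ + 1 := by
      have h := hFη hdist
      rw [dist_eq_norm] at h
      have e : F p + (F z - F p) = F z := by ring
      have := norm_add_le (F p) (F z - F p)
      rw [e] at this; linarith
    have hCt : C * ((t : ℂ))⁻¹ = F z - ∑' i, regTerm (c i) (u i) p z := by
      rw [hFz, hsplit]; ring
    have hnorm : ‖C‖ / t = ‖C * ((t : ℂ))⁻¹‖ := by
      rw [norm_mul, norm_inv, Complex.norm_real, Real.norm_eq_abs, abs_of_pos ht, div_eq_mul_inv]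
    have : ‖C‖ / t ≤ L := by
      rw [hnorm, hCt]
      calc ‖F z - ∑' i, regTerm (c i) (u i) p z‖ ≤ ‖F z‖ + ‖∑' i, regTerm (c i) (u i) p z‖ :=
            norm_sub_le _ _
        _ ≤ ‖F p‖ + 1 + M := add_le_add hFb hrb
    rwa [div_le_iff₀ ht, mul_comm] at this
  -- let `t → 0`
  have hC0 : ‖C‖ ≤ 0 := by
    refine le_of_forall_pos_le_add fun δ hδ ↦ ?_
    set t : ℝ := min (min ε η / 2) (δ / (L + 1)) with ht
    have hmin : 0 < min ε η := lt_min hε hη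
    have htpos : 0 < t := lt_min (by linarith) (by positivity)
    have htlt : t < min ε η := lt_of_le_of_lt (min_le_left _ _) (by linarith)
    have h := key t htpos htlt
    have htδ : t ≤ δ / (L + 1) := min_le_right _ _
    calc ‖C‖ ≤ t * L := h
      _ ≤ (δ / (L + 1)) * L := by gcongr
      _ ≤ 0 + δ := by
          rw [zero_add, div_mul_eq_mul_div, div_le_iff₀ (by linarith)]
          nlinarith
  exact norm_le_zero_iff.1 hC0

end Summit.RiemannHypothesis.RiemannHypothesis.Theorems.Splittings.ScrewBorel
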